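import Summits.AtomisticToContinuum.HydrodynamicLimit.Theorems.JParityClosureOddContactSymmetryCollisionWindowEvents
import HarnessLib

/-!
# The rung-0 collision-count bound: the window / first-moment assembly
# (crux `JParityClosure.OddContactSymmetry`, stmt-AtomisticToContinuum-13078, line
# `equilibrium-rung-mean-variance`, transfer debt "tightness" = `CollisionTightness` (stmt-13085) at rung 0)

Lead prover r-1 of the crux.  For CONSTANT profiles the local Gibbs law `G_N` is invariant under every
hard-sphere flow `Φ` (`map_flow_localGibbsLaw_const`, p72343) and energy shells are invariant
(`HardSphereFlow.configEnergy_flow`).  Chop `[0, τ]` into `m` windows of length `δ = τ/m`.  By window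
subadditivity and the truncation arithmetic (`…CollisionWindows`), on the shell `E ≤ V²/2`

  `min(count[0,τ], M) ≤ Σ_k (𝟙[count_k ≥ 1] + (M-1)·𝟙[count_k ≥ 2])`,

and by invariance every window has the probabilities of window `0` (`localGibbsLaw_window_one/two`).
The window-`0` events are STATIC events of the initial datum by the window kinematics
(`…WindowKinematics`): a collision in `[0, δ]` forces a pair at distance `[ε, ε + (‖vᵢ‖+‖vⱼ‖)δ]` (D1), two
collision times force two distinct `(ε + 2Vδ)`-close pairs (D2).  Hence, GIVEN static bounds
`G_N[one close pair] ≤ F δ + C₁ δ²` and `G_N[two close pairs at width h] ≤ C₂ h²` (proved in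
`…WindowStatics`), `∫_{E ≤ V²/2} min(count, M) ≤ F τ + O_{M,V}(τ²/m)`; letting `m → ∞`, then `M → ∞`
and `V → ∞` (monotone convergence) gives the first-moment bound

  `lintegral_numCollisions_le_of_static`:  `∫ 𝟙_good · numCollisions[0, τ] dG_N ≤ F τ`

for EVERY hard-sphere flow (the count extended by `0` off the good set, where it is measurable,
`measurable_indicator_numCollisions`).  With the static constants of `…WindowStatics`,
`F = 12 v₁ ε² (N+1)N · 2E‖v‖ ≍ σ² (N+1)^{4/3}`: the Boltzmann–Enskog collision frequency as an upper
bound, i.e. `ε/(N+1) · E[count] = O(σ³ τ)` uniformly in `N` (collision tightness at rung 0).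

References: Cercignani–Illner–Pulvirenti 1994 §2.2, App. 4.A; Gallagher–Saint-Raymond–Texier 2013,
Prop. 4.1.1, Lemma 4.1.2; Spohn 1991, Part I §2.3.
-/


noncomputable section

open MeasureTheory Set Filter Topology
open scoped ENNReal InnerProductSpace BigOperators

namespace Summit.AtomisticToContinuum.HydrodynamicLimit.Theorems

open Literature.Analysis.FluidPDE Literature.MathematicalPhysics.KineticTheory

section Assembly

variable {σ a θ : ℝ} {u : V3} {N : ℕ}
  {Φ : HardSphereFlow (Torus.geometry (Fin 3)) (hsDiameter σ N) (N + 1)}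

/-- **Pointwise window inequality** behind the first-moment bound: on the energy shell, the truncated
count of `[0, mδ]` is dominated by the sum over the `m` windows of
`𝟙[window count ≥ 1] + (M-1)·𝟙[window count ≥ 2]`. [folklore] -/
theorem indicator_min_numCollisions_le (V : ℝ) {δ : ℝ} (hδ : 0 ≤ δ) {m : ℕ} (hm : 0 < m) {M : ℕ}
    (hM : 1 ≤ M) (z : Config (N + 1) (Fin 3) T3) :
    {z : Config (N + 1) (Fin 3) T3 | configEnergy z ≤ V ^ 2 / 2}.indicator
        (fun z => min (Φ.good.indicator (fun z => (numCollisions (Torus.geometry (Fin 3))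
          (hsDiameter σ N) (fun s => Φ.flow s z) 0 (m * δ) : ℝ≥0∞)) z) M) z ≤
      ∑ k ∈ Finset.range m,
        ({z | 1 ≤ Φ.good.indicator (fun z => (numCollisions (Torus.geometry (Fin 3)) (hsDiameter σ N)
            (fun s => Φ.flow s z) (k * δ) ((k + 1) * δ) : ℝ≥0∞)) z}.indicator
            (1 : Config (N + 1) (Fin 3) T3 → ℝ≥0∞) z +
          ((M - 1 : ℕ) : ℝ≥0∞) * ({z : Config (N + 1) (Fin 3) T3 | configEnergy z ≤ V ^ 2 / 2} ∩
            {z | 2 ≤ Φ.good.indicator (fun z => (numCollisions (Torus.geometry (Fin 3))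
              (hsDiameter σ N) (fun s => Φ.flow s z) (k * δ) ((k + 1) * δ) : ℝ≥0∞)) z}).indicator
              (1 : Config (N + 1) (Fin 3) T3 → ℝ≥0∞) z) := by
  by_cases hzE : z ∈ {z : Config (N + 1) (Fin 3) T3 | configEnergy z ≤ V ^ 2 / 2}
  swap
  · rw [indicator_of_notMem hzE]; exact zero_le
  rw [indicator_of_mem hzE]
  by_cases hg : z ∈ Φ.good
  swap
  · simp [indicator_of_notMem hg]
  rw [indicator_of_mem hg]
  set n : ℕ → ℕ := fun k => numCollisions (Torus.geometry (Fin 3)) (hsDiameter σ N)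
    (fun s => Φ.flow s z) (k * δ) ((k + 1) * δ) with hn
  have htot : numCollisions (Torus.geometry (Fin 3)) (hsDiameter σ N) (fun s => Φ.flow s z) 0 (m * δ) ≤
      ∑ k ∈ Finset.range m, n k := by
    have h := numCollisions_le_sum_windows (Φ.isTrajectory z hg) 0 hδ hm
    simpa only [zero_add] using h
  have hmin := min_le_sum_min (Finset.range m) n (M := M) htot
  calc min ((numCollisions (Torus.geometry (Fin 3)) (hsDiameter σ N) (fun s => Φ.flow s z) 0 (m * δ) : ℕ) : ℝ≥0∞) M
      = ((min (numCollisions (Torus.geometry (Fin 3)) (hsDiameter σ N) (fun s => Φ.flow s z) 0 (m * δ)) M : ℕ) : ℝ≥0∞) :=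
        ((Nat.mono_cast (α := ℝ≥0∞)).map_min).symm
    _ ≤ ((∑ k ∈ Finset.range m, min (n k) M : ℕ) : ℝ≥0∞) := by exact_mod_cast hmin
    _ = ∑ k ∈ Finset.range m, ((min (n k) M : ℕ) : ℝ≥0∞) := Nat.cast_sum _ _
    _ ≤ _ := Finset.sum_le_sum fun k _ => ?_
  refine (min_le_indicator_add (n k) hM).trans ?_
  gcongr
  · -- 𝟙[n k ≥ 1]
    by_cases h1 : 1 ≤ n k
    · rw [if_pos h1, indicator_of_mem]; · simp
      rw [mem_setOf_eq, indicator_of_mem hg]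
      change (1 : ℝ≥0∞) ≤ ((n k : ℕ) : ℝ≥0∞)
      exact_mod_cast h1
    · rw [if_neg h1]; exact zero_le
  · by_cases h2 : 2 ≤ n k
    · rw [if_pos h2, indicator_of_mem]; · simp
      refine ⟨hzE, ?_⟩
      rw [mem_setOf_eq, indicator_of_mem hg]
      change (2 : ℝ≥0∞) ≤ ((n k : ℕ) : ℝ≥0∞)
      exact_mod_cast h2
    · rw [if_neg h2]; exact zero_le


/-- **Integrated window inequality with invariance**: on the energy shell,
`∫ min(count[0, mδ], M) dG_N ≤ m · (G_N[window-0 count ≥ 1] + (M-1) · G_N[shell ∧ window-0 count ≥ 2])`.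
[folklore] -/
theorem lintegral_indicator_min_le (hσ : 0 < σ) (hσ2 : σ < 2⁻¹) (V : ℝ) {δ : ℝ} (hδ : 0 ≤ δ)
    {m : ℕ} (hm : 0 < m) {M : ℕ} (hM : 1 ≤ M) :
    ∫⁻ z, {z : Config (N + 1) (Fin 3) T3 | configEnergy z ≤ V ^ 2 / 2}.indicator
        (fun z => min (Φ.good.indicator (fun z => (numCollisions (Torus.geometry (Fin 3))
          (hsDiameter σ N) (fun s => Φ.flow s z) 0 (m * δ) : ℝ≥0∞)) z) M) z
        ∂(localGibbsLaw σ (fun _ => a) (fun _ => u) (fun _ => θ) N Φ) ≤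
      m * (localGibbsLaw σ (fun _ => a) (fun _ => u) (fun _ => θ) N Φ
          {z | 1 ≤ Φ.good.indicator (fun z => (numCollisions (Torus.geometry (Fin 3)) (hsDiameter σ N)
            (fun s => Φ.flow s z) 0 δ : ℝ≥0∞)) z} +
        (M - 1 : ℕ) * localGibbsLaw σ (fun _ => a) (fun _ => u) (fun _ => θ) N Φ
          ({z : Config (N + 1) (Fin 3) T3 | configEnergy z ≤ V ^ 2 / 2} ∩
            {z | 2 ≤ Φ.good.indicator (fun z => (numCollisions (Torus.geometry (Fin 3))
              (hsDiameter σ N) (fun s => Φ.flow s z) 0 δ : ℝ≥0∞)) z})) := by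
  have hε2 : hsDiameter σ N < 2⁻¹ := (hsDiameter_le hσ.le N).trans_lt hσ2
  set μ := localGibbsLaw σ (fun _ => a) (fun _ => u) (fun _ => θ) N Φ with hμ
  -- the window events and their measurability
  set A : ℕ → Set (Config (N + 1) (Fin 3) T3) := fun k =>
    {z | 1 ≤ Φ.good.indicator (fun z => (numCollisions (Torus.geometry (Fin 3)) (hsDiameter σ N)
      (fun s => Φ.flow s z) (k * δ) ((k + 1) * δ) : ℝ≥0∞)) z} with hA
  set B : ℕ → Set (Config (N + 1) (Fin 3) T3) := fun k =>
    {z : Config (N + 1) (Fin 3) T3 | configEnergy z ≤ V ^ 2 / 2} ∩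
      {z | 2 ≤ Φ.good.indicator (fun z => (numCollisions (Torus.geometry (Fin 3)) (hsDiameter σ N)
        (fun s => Φ.flow s z) (k * δ) ((k + 1) * δ) : ℝ≥0∞)) z} with hB
  have hAm : ∀ k, MeasurableSet (A k) := fun k =>
    measurableSet_le measurable_const (measurable_indicator_numCollisions hε2 Φ _ _)
  have hBm : ∀ k, MeasurableSet (B k) := fun k =>
    (measurableSet_le measurable_configEnergy_T3 measurable_const).inter
      (measurableSet_le measurable_const (measurable_indicator_numCollisions hε2 Φ _ _))
  calc _ ≤ ∫⁻ z, ∑ k ∈ Finset.range m, ((A k).indicator (1 : Config (N + 1) (Fin 3) T3 → ℝ≥0∞) z +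
          ((M - 1 : ℕ) : ℝ≥0∞) * (B k).indicator (1 : Config (N + 1) (Fin 3) T3 → ℝ≥0∞) z) ∂μ :=
        lintegral_mono fun z => indicator_min_numCollisions_le (Φ := Φ) V hδ hm hM z
    _ = ∑ k ∈ Finset.range m, (μ (A k) + (M - 1 : ℕ) * μ (B k)) := by
        rw [lintegral_finsetSum _ fun k _ => ?_]
        · refine Finset.sum_congr rfl fun k _ => ?_
          rw [lintegral_add_left (measurable_one.indicator (hAm k)),
            lintegral_const_mul _ (measurable_one.indicator (hBm k)), lintegral_indicator_one (hAm k),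
            lintegral_indicator_one (hBm k)]
        · exact (measurable_one.indicator (hAm k)).add
            (measurable_const.mul (measurable_one.indicator (hBm k)))
    _ = ∑ _k ∈ Finset.range m, (μ (A 0) + (M - 1 : ℕ) * μ (B 0)) := by
        refine Finset.sum_congr rfl fun k _ => ?_
        rw [hμ, hA, hB]
        dsimp only
        rw [localGibbsLaw_window_one hσ hσ2 δ k, localGibbsLaw_window_two hσ hσ2 V δ k,
          ← localGibbsLaw_window_one (a := a) (θ := θ) (u := u) (Φ := Φ) hσ hσ2 δ 0,
          ← localGibbsLaw_window_two (a := a) (θ := θ) (u := u) (Φ := Φ) hσ hσ2 V δ 0]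
    _ = m * (μ (A 0) + (M - 1 : ℕ) * μ (B 0)) := by
        rw [Finset.sum_const, Finset.card_range, nsmul_eq_mul]
    _ = _ := by
        rw [hA, hB]
        simp only [CharP.cast_eq_zero, zero_mul, zero_add, one_mul]


/-- **Shell-truncated bound from the static window estimates.**  If the one-collision close-pair event
has probability `≤ F δ + C₁ δ²` and the two-close-pairs event at width `h ≤ h₀` has probability
`≤ C₂ h²`, then for every energy shell `E ≤ V²/2` and truncation level `M`,
`∫_{E ≤ V²/2} min(count[0,τ], M) dG_N ≤ F τ` (windows `δ = τ/m`, `m → ∞`). [folklore] -/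
theorem lintegral_indicator_min_le_of_static (hσ : 0 < σ) (hσ2 : σ < 2⁻¹) {F C₁ C₂ h₀ : ℝ}
    (hF : 0 ≤ F) (hC₁ : 0 ≤ C₁) (hC₂ : 0 ≤ C₂) (hh₀ : 0 < h₀)
    (hS1 : ∀ δ : ℝ, 0 ≤ δ → localGibbsLaw σ (fun _ => a) (fun _ => u) (fun _ => θ) N Φ
      {z | ∃ i j : Fin (N + 1), i ≠ j ∧ hsDiameter σ N ≤ Torus.euclidDist (z i).1 (z j).1 ∧
        Torus.euclidDist (z i).1 (z j).1 ≤ hsDiameter σ N + (‖(z i).2‖ + ‖(z j).2‖) * δ} ≤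
      ENNReal.ofReal (F * δ + C₁ * δ ^ 2))
    (hS2 : ∀ h : ℝ, 0 ≤ h → h ≤ h₀ → localGibbsLaw σ (fun _ => a) (fun _ => u) (fun _ => θ) N Φ
      {z | ∃ i j k l : Fin (N + 1), i ≠ j ∧ k ≠ l ∧ ({i, j} : Finset (Fin (N + 1))) ≠ {k, l} ∧
        Torus.euclidDist (z i).1 (z j).1 ≤ hsDiameter σ N + h ∧
        Torus.euclidDist (z k).1 (z l).1 ≤ hsDiameter σ N + h} ≤ ENNReal.ofReal (C₂ * h ^ 2))
    {V : ℝ} (hV : 0 ≤ V) {M : ℕ} (hM : 1 ≤ M) {τ : ℝ} (hτ : 0 ≤ τ) :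
    ∫⁻ z, {z : Config (N + 1) (Fin 3) T3 | configEnergy z ≤ V ^ 2 / 2}.indicator
        (fun z => min (Φ.good.indicator (fun z => (numCollisions (Torus.geometry (Fin 3))
          (hsDiameter σ N) (fun s => Φ.flow s z) 0 τ : ℝ≥0∞)) z) M) z
        ∂(localGibbsLaw σ (fun _ => a) (fun _ => u) (fun _ => θ) N Φ) ≤ ENNReal.ofReal (F * τ) := by
  have hε : 0 < hsDiameter σ N := hsDiameter_pos hσ N
  have hε2 : hsDiameter σ N < 2⁻¹ := (hsDiameter_le hσ.le N).trans_lt hσ2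
  set μ := localGibbsLaw σ (fun _ => a) (fun _ => u) (fun _ => θ) N Φ with hμ
  set K : ℝ := C₁ + (M - 1 : ℕ) * (C₂ * (4 * V ^ 2)) with hK
  have hK0 : 0 ≤ K := by rw [hK]; positivity
  set X := ∫⁻ z, {z : Config (N + 1) (Fin 3) T3 | configEnergy z ≤ V ^ 2 / 2}.indicator
        (fun z => min (Φ.good.indicator (fun z => (numCollisions (Torus.geometry (Fin 3))
          (hsDiameter σ N) (fun s => Φ.flow s z) 0 τ : ℝ≥0∞)) z) M) z ∂μ with hX
  -- the bound for every fine enough window decomposition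
  have hstep : ∀ m : ℕ, 0 < m → 2 * V * (τ / m) ≤ h₀ → 2 * V * (τ / m) < (2⁻¹ - hsDiameter σ N) / 2 →
      X ≤ ENNReal.ofReal (F * τ + K * τ ^ 2 / m) := by
    intro m hm h1 h2
    have hm' : (0 : ℝ) < m := by exact_mod_cast hm
    set δ : ℝ := τ / m with hδdef
    have hδ : 0 ≤ δ := div_nonneg hτ hm'.le
    have hτm : (m : ℝ) * δ = τ := by rw [hδdef]; field_simp
    have hX' : X = ∫⁻ z, {z : Config (N + 1) (Fin 3) T3 | configEnergy z ≤ V ^ 2 / 2}.indicator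
        (fun z => min (Φ.good.indicator (fun z => (numCollisions (Torus.geometry (Fin 3))
          (hsDiameter σ N) (fun s => Φ.flow s z) 0 (m * δ) : ℝ≥0∞)) z) M) z ∂μ := by
      rw [hX, hτm]
    rw [hX']
    refine (lintegral_indicator_min_le hσ hσ2 V hδ hm hM).trans ?_
    -- static bounds on the two window-0 events
    have hA : μ {z | 1 ≤ Φ.good.indicator (fun z => (numCollisions (Torus.geometry (Fin 3))
        (hsDiameter σ N) (fun s => Φ.flow s z) 0 δ : ℝ≥0∞)) z} ≤ ENNReal.ofReal (F * δ + C₁ * δ ^ 2) :=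
      (measure_mono (setOf_one_le_numCollisions_subset hσ hσ2 hδ)).trans (hS1 δ hδ)
    have hB : μ ({z : Config (N + 1) (Fin 3) T3 | configEnergy z ≤ V ^ 2 / 2} ∩
        {z | 2 ≤ Φ.good.indicator (fun z => (numCollisions (Torus.geometry (Fin 3))
          (hsDiameter σ N) (fun s => Φ.flow s z) 0 δ : ℝ≥0∞)) z}) ≤
        ENNReal.ofReal (C₂ * (2 * V * δ) ^ 2) :=
      (measure_mono (setOf_two_le_numCollisions_subset hσ hσ2 hV hδ h2)).trans
        (hS2 _ (by positivity) h1)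
    calc (m : ℝ≥0∞) * (μ _ + (M - 1 : ℕ) * μ _)
        ≤ (m : ℝ≥0∞) * (ENNReal.ofReal (F * δ + C₁ * δ ^ 2) +
            (M - 1 : ℕ) * ENNReal.ofReal (C₂ * (2 * V * δ) ^ 2)) := by gcongr
      _ = ENNReal.ofReal (m * ((F * δ + C₁ * δ ^ 2) + (M - 1 : ℕ) * (C₂ * (2 * V * δ) ^ 2))) := by
          rw [← ENNReal.ofReal_natCast (M - 1), ← ENNReal.ofReal_mul (by positivity),
            ← ENNReal.ofReal_add (by positivity) (by positivity), ← ENNReal.ofReal_natCast m,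
            ← ENNReal.ofReal_mul (by positivity)]
      _ = ENNReal.ofReal (F * τ + K * τ ^ 2 / m) := by
          congr 1
          rw [hK, ← hτm]
          field_simp
          ring
  -- let the number of windows tend to infinity
  have htend : Tendsto (fun m : ℕ => ENNReal.ofReal (F * τ + K * τ ^ 2 / m)) atTop
      (𝓝 (ENNReal.ofReal (F * τ))) := by
    refine ENNReal.tendsto_ofReal ?_
    have h := (tendsto_const_div_atTop_nhds_zero_nat (K * τ ^ 2)).const_add (F * τ)
    simpa only [add_zero] using h
  refine ge_of_tendsto htend ?_
  -- eventually all three smallness conditions hold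
  have hev1 : ∀ᶠ m : ℕ in atTop, 0 < m := eventually_gt_atTop 0
  have hsmall : Tendsto (fun m : ℕ => 2 * V * (τ / m)) atTop (𝓝 0) := by
    have h := (tendsto_const_div_atTop_nhds_zero_nat τ).const_mul (2 * V)
    simpa only [mul_zero] using h
  have hev2 : ∀ᶠ m : ℕ in atTop, 2 * V * (τ / m) ≤ h₀ :=
    (hsmall.eventually (ge_mem_nhds hh₀)).mono fun m hm => hm
  have hgap : 0 < (2⁻¹ - hsDiameter σ N) / 2 := by linarith
  have hev3 : ∀ᶠ m : ℕ in atTop, 2 * V * (τ / m) < (2⁻¹ - hsDiameter σ N) / 2 :=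
    (hsmall.eventually (gt_mem_nhds hgap)).mono fun m hm => hm
  filter_upwards [hev1, hev2, hev3] with m h1 h2 h3
  exact hstep m h1 h2 h3

/-- **The rung-0 collision-count bound from the static window estimates** (monotone convergence in the
truncation level and in the energy shell). [folklore] -/
theorem lintegral_numCollisions_le_of_static (hσ : 0 < σ) (hσ2 : σ < 2⁻¹) {F C₁ C₂ h₀ : ℝ}
    (hF : 0 ≤ F) (hC₁ : 0 ≤ C₁) (hC₂ : 0 ≤ C₂) (hh₀ : 0 < h₀)
    (hS1 : ∀ δ : ℝ, 0 ≤ δ → localGibbsLaw σ (fun _ => a) (fun _ => u) (fun _ => θ) N Φ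
      {z | ∃ i j : Fin (N + 1), i ≠ j ∧ hsDiameter σ N ≤ Torus.euclidDist (z i).1 (z j).1 ∧
        Torus.euclidDist (z i).1 (z j).1 ≤ hsDiameter σ N + (‖(z i).2‖ + ‖(z j).2‖) * δ} ≤
      ENNReal.ofReal (F * δ + C₁ * δ ^ 2))
    (hS2 : ∀ h : ℝ, 0 ≤ h → h ≤ h₀ → localGibbsLaw σ (fun _ => a) (fun _ => u) (fun _ => θ) N Φ
      {z | ∃ i j k l : Fin (N + 1), i ≠ j ∧ k ≠ l ∧ ({i, j} : Finset (Fin (N + 1))) ≠ {k, l} ∧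
        Torus.euclidDist (z i).1 (z j).1 ≤ hsDiameter σ N + h ∧
        Torus.euclidDist (z k).1 (z l).1 ≤ hsDiameter σ N + h} ≤ ENNReal.ofReal (C₂ * h ^ 2))
    {τ : ℝ} (hτ : 0 ≤ τ) :
    ∫⁻ z, Φ.good.indicator (fun z => (numCollisions (Torus.geometry (Fin 3)) (hsDiameter σ N)
        (fun s => Φ.flow s z) 0 τ : ℝ≥0∞)) z
        ∂(localGibbsLaw σ (fun _ => a) (fun _ => u) (fun _ => θ) N Φ) ≤ ENNReal.ofReal (F * τ) := by
  have hε2 : hsDiameter σ N < 2⁻¹ := (hsDiameter_le hσ.le N).trans_lt hσ2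
  set μ := localGibbsLaw σ (fun _ => a) (fun _ => u) (fun _ => θ) N Φ with hμ
  set f : Config (N + 1) (Fin 3) T3 → ℝ≥0∞ := Φ.good.indicator (fun z =>
    (numCollisions (Torus.geometry (Fin 3)) (hsDiameter σ N) (fun s => Φ.flow s z) 0 τ : ℝ≥0∞)) with hf
  have hfm : Measurable f := measurable_indicator_numCollisions hε2 Φ 0 τ
  have hfnat : ∀ z, ∃ n : ℕ, f z = n := by
    intro z
    by_cases hz : z ∈ Φ.good
    · exact ⟨_, by rw [hf, indicator_of_mem hz]⟩
    · exact ⟨0, by rw [hf, indicator_of_notMem hz, Nat.cast_zero]⟩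
  set S : ℕ → Set (Config (N + 1) (Fin 3) T3) := fun V => {z | configEnergy z ≤ (V : ℝ) ^ 2 / 2} with hS
  have hSm : ∀ V, MeasurableSet (S V) := fun V => measurableSet_le measurable_configEnergy_T3 measurable_const
  -- (1) truncation level: `∫_{S V} f = ⨆_M ∫_{S V} min(f, M) ≤ F τ`
  have hshell : ∀ V : ℕ, ∫⁻ z, (S V).indicator f z ∂μ ≤ ENNReal.ofReal (F * τ) := by
    intro V
    have hmono : Monotone fun M : ℕ => fun z => (S V).indicator (fun z => min (f z) M) z := by
      intro M M' hMM' z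
      refine indicator_le_indicator ?_
      exact min_le_min le_rfl (by exact_mod_cast hMM')
    have hmeas : ∀ M : ℕ, Measurable fun z => (S V).indicator (fun z => min (f z) M) z := fun M =>
      (hfm.min measurable_const).indicator (hSm V)
    have hsup : (fun z => (S V).indicator f z) = fun z => ⨆ M : ℕ, (S V).indicator (fun z => min (f z) M) z := by
      funext z
      by_cases hz : z ∈ S V
      · simp only [indicator_of_mem hz]
        obtain ⟨n, hn⟩ := hfnat z
        rw [hn]
        refine le_antisymm (le_iSup_of_le n (by rw [min_self])) (iSup_le fun M => min_le_left _ _)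
      · simp only [indicator_of_notMem hz, iSup_const]  -- hmm: `⨆ M, 0 = 0`
    rw [hsup, lintegral_iSup hmeas hmono]
    refine iSup_le fun M => ?_
    rcases Nat.eq_zero_or_pos M with hM0 | hMpos
    · subst hM0
      simp
    · exact lintegral_indicator_min_le_of_static hσ hσ2 hF hC₁ hC₂ hh₀ hS1 hS2 (Nat.cast_nonneg V) hMpos hτ
  -- (2) energy shells: `∫ f = ⨆_V ∫_{S V} f`
  have hmonoV : Monotone fun V : ℕ => fun z => (S V).indicator f z := by
    intro V V' hVV' z
    refine indicator_le_indicator_of_subset (fun z hz => ?_) (fun _ => zero_le) z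
    simp only [hS, mem_setOf_eq] at hz ⊢
    have : (V : ℝ) ^ 2 ≤ (V' : ℝ) ^ 2 := pow_le_pow_left₀ (Nat.cast_nonneg _) (by exact_mod_cast hVV') 2
    linarith
  have hmeasV : ∀ V : ℕ, Measurable fun z => (S V).indicator f z := fun V => hfm.indicator (hSm V)
  have hsupV : f = fun z => ⨆ V : ℕ, (S V).indicator f z := by
    funext z
    obtain ⟨V, hV⟩ := exists_nat_ge (Real.sqrt (2 * configEnergy z))
    have hzV : z ∈ S V := by
      simp only [hS, mem_setOf_eq]
      have h0 : 0 ≤ configEnergy z := by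
        rw [configEnergy]; positivity
      have h1 : 2 * configEnergy z ≤ (V : ℝ) ^ 2 := by
        calc 2 * configEnergy z = Real.sqrt (2 * configEnergy z) ^ 2 := by
              rw [Real.sq_sqrt (by linarith)]
          _ ≤ (V : ℝ) ^ 2 := by gcongr
      linarith
    refine le_antisymm (le_iSup_of_le V (by rw [indicator_of_mem hzV])) (iSup_le fun V' => ?_)
    exact indicator_le_self _ _ _
  calc ∫⁻ z, f z ∂μ = ∫⁻ z, ⨆ V : ℕ, (S V).indicator f z ∂μ := by rw [← hsupV]
    _ = ⨆ V : ℕ, ∫⁻ z, (S V).indicator f z ∂μ := lintegral_iSup hmeasV hmonoV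
    _ ≤ ENNReal.ofReal (F * τ) := iSup_le hshell


end Assembly

/-- **Registered helper stub `stub_collisionCountBoundStatic`** of crux stmt-AtomisticToContinuum-13078
(rung-0 collision-count bound, part 4: the first-moment bound from the static window estimates, for every
hard-sphere flow; = `lintegral_numCollisions_le_of_static` in signature form). [folklore] -/
theorem stub_collisionCountBoundStatic :
    ∀ (σ a θ : ℝ) (u : V3) (N : ℕ) (Φ : HardSphereFlow (Torus.geometry (Fin 3)) (hsDiameter σ N) (N + 1)) (F C₁ C₂ h₀ : ℝ), 0 < σ → σ < 2⁻¹ → 0 ≤ F → 0 ≤ C₁ → 0 ≤ C₂ → 0 < h₀ → (∀ δ : ℝ, 0 ≤ δ → localGibbsLaw σ (fun _ => a) (fun _ => u) (fun _ => θ) N Φ {z | ∃ i j : Fin (N + 1), i ≠ j ∧ hsDiameter σ N ≤ Torus.euclidDist (z i).1 (z j).1 ∧ Torus.euclidDist (z i).1 (z j).1 ≤ hsDiameter σ N + (‖(z i).2‖ + ‖(z j).2‖) * δ} ≤ ENNReal.ofReal (F * δ + C₁ * δ ^ 2)) → (∀ h : ℝ, 0 ≤ h → h ≤ h₀ → localGibbsLaw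 σ (fun _ => a) (fun _ => u) (fun _ => θ) N Φ {z | ∃ i j k l : Fin (N + 1), i ≠ j ∧ k ≠ l ∧ ({i, j} : Finset (Fin (N + 1))) ≠ {k, l} ∧ Torus.euclidDist (z i).1 (z j).1 ≤ hsDiameter σ N + h ∧ Torus.euclidDist (z k).1 (z l).1 ≤ hsDiameter σ N + h} ≤ ENNReal.ofReal (C₂ * h ^ 2)) → ∀ τ : ℝ, 0 ≤ τ → ∫⁻ z, Φ.good.indicator (fun z => (numCollisions (Torus.geometry (Fin 3)) (hsDiameter σ N) (fun s => Φ.flow s z) 0 τ : ℝ≥0∞)) z ∂(localGibbsLaw σ (fun _ => a) (fun _ => u) (fun _ => θ) N Φ) ≤ ENNReal.ofReal (F * τ) :=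
  fun _σ _a _θ _u _N _Φ _F _C₁ _C₂ _h₀ hσ hσ2 hF hC₁ hC₂ hh₀ hS1 hS2 _τ hτ =>
    lintegral_numCollisions_le_of_static hσ hσ2 hF hC₁ hC₂ hh₀ hS1 hS2 hτ


end Summit.AtomisticToContinuum.HydrodynamicLimit.Theorems

end
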